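import Literature.AlgebraicGeometry.ShimuraVarieties.UnitaryCurveAuxiliaryPeriodLevelTransport
import Literature.AlgebraicGeometry.ShimuraVarieties.UnitaryCurveAuxiliaryPeriodLieType
import HarnessLib

/-!
# The `Z_equivariant` field of the auxiliary Siegel chart, discharged (E6-eq layer (b), E-line token shape)

Topic `AlgebraicGeometry/ShimuraVarieties`; namespace `Literature.AlgebraicGeometry.ShimuraVarieties.UnitaryCurve.AuxV`.  THEOREMS ONLY (no `def`, no named
fact, no instance, no notation, no `sorry`).  Cell `hodgecm-mathlib` (D-0151), FLOOR 0, P6 «MOD programme», door (E) of `stub_RGD`, E-line `F0_P6a_PELWitnessE`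
ED. 2 (M-23, GEN heir A-p18 (g31)): the `AuxChartGS` field **(M-eq) `Z_equivariant`** («period equivariance with `Mρ`-commuting level monodromy», A-p06 (g32)
MEMO 07c2eec7 §1, LEAD F0P6-plan (g2) ruling 22:58:38Z).  `--supports stmt-HodgeConjecture-24832`, count-neutral; HC_CM is proved only modulo the printed
citations until rung 0 closes.

* `exists_siegelLevelGroup_lattice_transport_comm_reading` — THE FIELD BODY, token for token, from the outputs of the mover chart (★ E3 FILE D ∕ ★ junction
  `exists_siegelChartGS_auxComplexStructureV_mover`: `rep`, `piece`, `Z`, `q` with `Z_mem` and clause (Q)) and of the conjugated lattice reading (★ E1 FILE 9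
  `exists_chartActionReading`: `Mρ` with its real-avatar clause): for `γ ∈ Γ(aKa⁻¹)` (★ `arithmeticLevel` at `K.map (conj a)`), cone vectors `v, v′` with
  `γ^τ v = c • v′` (`c ≠ 0`): `∃ M ∈ Γ_δ(N), ∃ L, (∀ w, L (Π_{Z a v} w) = Π_{Z a v′} (intAct M w)) ∧ ∀ b, M · Mρ a b = Mρ a b · M` — one `obtain` on ★ layer (b)
  `exists_siegelLevelGroup_transport_of_mover` (the monodromy `M` is the INTEGRAL image `q_a⁻¹ N_γ q_a` of `γ`, [Deligne 1971] 4.16; it commutes with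
  `Mρ a b = q_a⁻¹ ρ(b) q_a` because `γ` is `M`-linear).

## References
* [Deligne1971TravauxShimura] P. Deligne, *Travaux de Shimura* (1971), Prop. 1.15 p. 132, Exemple 4.16 p. 150.
* [Deligne1979ShimuraVarieties] P. Deligne, *Variétés de Shimura* (1979), Prop. 2.3.10 (PDF p. 32 of Milne's translation).
* [Milne2005ShimuraVarieties] J. S. Milne, *Introduction to Shimura varieties* (2005), Lemma 5.13 p. 57, §6 p. 70.
* [Lange2023AbelianVarietiesComplex] H. Lange, *Abelian Varieties over the Complex Numbers* (2023), §3.1.2 Prop. 3.1.4 (p0159–p0160), §7.1.2 Lemma 7.1.7.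
-/

set_option autoImplicit false

noncomputable section

open Matrix NumberField
open scoped TensorProduct

namespace Literature.AlgebraicGeometry.ShimuraVarieties

namespace UnitaryCurve

namespace AuxV

open Literature.AlgebraicGeometry.ModuliOfAbelianVarieties
open Literature.AlgebraicGeometry.ModuliOfAbelianVarieties.SiegelModuli
open Literature.AlgebraicGeometry.Motives (CMType)
open Literature.NumberTheory.Automorphic (siegelUpperHalfSpace)
open Literature.NumberTheory.Automorphic.UnitaryGroup

variable {L : Type} [Field L] [NumberField L] [IsCMField L] (M : Type) [Field M] [NumberField M] [IsCMField M] {j : L →+* M}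
  {n : ℕ} {H : Matrix (Fin n) (Fin n) L} {ξ : M} {g : ℕ} {δ : Fin g → ℕ} {N : ℕ}
  (F : SymplecticFrameV M j H ξ g δ) (Φ : CMType M) (τ : L →+* ℂ)

/-- **THE `Z_equivariant` FIELD BODY** (A-p06 (g32) MEMO (M-eq) §1, E-line ED. 2): from the mover chart's `rep ∕ piece ∕ Z ∕ q` with `Z_mem` and (Q)
(★ `exists_siegelChartGS_auxComplexStructureV_mover`), a source level `K ≤ b⁻¹ K_δ(N)` for `b := auxToGspFinV F ∘ inl`, integral representatives
`rep c ∈ K_δ(1)`, and a lattice reading `Mρ` with the real-avatar clause of ★ E1 FILE 9 `exists_chartActionReading` — for `γ ∈ Γ(aKa⁻¹)` and cone vectors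
on one `γ`-line (`γ^τ v = c • v′`, `c ≠ 0`): **`∃ M ∈ Γ_δ(N), ∃ L, (∀ w, L (Π_{Z a v} w) = Π_{Z a v′} (intAct M w)) ∧ ∀ b, M · Mρ a b = Mρ a b · M`**.
[cite: Deligne1971TravauxShimura, Prop. 1.15 p. 132, Exemple 4.16 p. 150] [cite: Deligne1979ShimuraVarieties, Prop. 2.3.10 (PDF p. 32)]
[cite: Milne2005ShimuraVarieties, Lemma 5.13 p. 57] [cite: Lange2023AbelianVarietiesComplex, §3.1.2 Prop. 3.1.4 (p0159–p0160)] -/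
theorem exists_siegelLevelGroup_lattice_transport_comm_reading (hg : 0 < g) (hδ : IsPolarizationType δ) (hN : 3 ≤ N)
    {K : Subgroup ↥(finAdelic (↥(maximalRealSubfield L)) L (IsCMField.complexConj L) n H)}
    (hle : K ≤ (principalLevelSubgroup δ N).comap ((auxToGspFinV F).comp (MonoidHom.inl _ _)))
    {ι : Type} {rep : ι → ↥(gspFinAdelic δ)} (hrep : ∀ c, rep c ∈ principalLevelSubgroup δ 1)
    {piece : ↥(finAdelic (↥(maximalRealSubfield L)) L (IsCMField.complexConj L) n H) → ι}
    {Z : ↥(finAdelic (↥(maximalRealSubfield L)) L (IsCMField.complexConj L) n H) → (Fin n → ℂ) → Matrix (Fin g) (Fin g) ℂ}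
    {q : ↥(finAdelic (↥(maximalRealSubfield L)) L (IsCMField.complexConj L) n H) → ↥(gspRational δ)}
    (hZmem : ∀ a (v : Fin n → ℂ), v ∈ negCone (H.map τ) → Z a v ∈ siegelUpperHalfSpace g)
    (hQ : ∀ (v : Fin n → ℂ), v ∈ negCone (H.map τ) → ∀ a,
      conjJ (((gspRationalToReal δ (q a))⁻¹ : ↥(gspReal δ)) : GL (Fin g ⊕ Fin g) ℝ) (auxComplexStructureV F τ Φ v) = jOfSiegel δ (Z a v) ∧
        gspRationalToFinAdelic δ (q a) • ((rep (piece a) : ↥(gspFinAdelic δ)) : ↥(gspFinAdelic δ) ⧸ principalLevelSubgroup δ N) =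
          ((auxToGspFinV F (a, 1) : ↥(gspFinAdelic δ)) : ↥(gspFinAdelic δ) ⧸ principalLevelSubgroup δ N))
    {Mρ : ↥(finAdelic (↥(maximalRealSubfield L)) L (IsCMField.complexConj L) n H) → (𝓞 M →+* Matrix (Fin g ⊕ Fin g) (Fin g ⊕ Fin g) ℤ)}
    (hMρ : ∀ (v : Fin n → ℂ), v ∈ negCone (H.map τ) → ∀ a (b : 𝓞 M) (t : (ℝ ⊗[ℚ] M)ˣ), (t : ℝ ⊗[ℚ] M) = (1 : ℝ) ⊗ₜ[ℚ] ((b : 𝓞 M) : M) →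
      (Mρ a b).map (Int.cast : ℤ → ℝ) =
        conjJ (((gspRationalToReal δ (q a))⁻¹ : ↥(gspReal δ)) : GL (Fin g ⊕ Fin g) ℝ)
          ((auxRepV ℝ F (t, 1) : GL (Fin g ⊕ Fin g) ℝ) : Matrix (Fin g ⊕ Fin g) (Fin g ⊕ Fin g) ℝ))
    (a : ↥(finAdelic (↥(maximalRealSubfield L)) L (IsCMField.complexConj L) n H)) (γ : GL (Fin n) L)
    (hγ : γ ∈ arithmeticLevel (↥(maximalRealSubfield L)) L (IsCMField.complexConj L) n H (K.map (MulAut.conj a).toMonoidHom))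
    (v : Fin n → ℂ) (hv : v ∈ negCone (H.map τ)) (v' : Fin n → ℂ) (hv' : v' ∈ negCone (H.map τ)) (c : ℂ) (hc : c ≠ 0)
    (hγv : ((γ : Matrix (Fin n) (Fin n) L).map τ) *ᵥ v = c • v') :
    ∃ Mz ∈ siegelLevelGroup δ N, ∃ Lc : (Fin g → ℂ) ≃ₗ[ℂ] (Fin g → ℂ),
      (∀ w : Fin g ⊕ Fin g → ℝ, Lc (siegelPeriodMap δ (Z a v) w) = siegelPeriodMap δ (Z a v') (intAct Mz w)) ∧
      ∀ b : 𝓞 M, ((Mz : GL (Fin g ⊕ Fin g) ℤ) : Matrix (Fin g ⊕ Fin g) (Fin g ⊕ Fin g) ℤ) * Mρ a b = Mρ a b * Mz := by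
  obtain ⟨hγr, hγK⟩ := exists_conj_mem_of_mem_arithmeticLevel_map (L := L) hγ
  have hb : ∀ γ' : rational (↥(maximalRealSubfield L)) L (IsCMField.complexConj L) n H,
      ((auxToGspFinV F).comp (MonoidHom.inl _ _)) (rationalToFinAdelic (↥(maximalRealSubfield L)) L (IsCMField.complexConj L) n H γ') =
        gspRationalToFinAdelic δ (auxToGspRatV F (γ', 1)) := fun γ' => by
    rw [MonoidHom.comp_apply, MonoidHom.inl_apply, gspRationalToFinAdelic_auxToGspRatV, map_one]
  have hqa : gspRationalToFinAdelic δ (q a) • ((rep (piece a) : ↥(gspFinAdelic δ)) : ↥(gspFinAdelic δ) ⧸ principalLevelSubgroup δ N) =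
      ((((auxToGspFinV F).comp (MonoidHom.inl _ _)) a : ↥(gspFinAdelic δ)) : ↥(gspFinAdelic δ) ⧸ principalLevelSubgroup δ N) :=
    (hQ v hv a).2
  obtain ⟨Mγ, hMN, -, -, -, ⟨Lc, hLc⟩, -, hcomm⟩ :=
    exists_siegelLevelGroup_transport_of_mover M F Φ τ hg hδ hN ((auxToGspFinV F).comp (MonoidHom.inl _ _)) hb hle (hrep (piece a)) hqa
      (hZmem a) (fun w hw => (hQ w hw a).1) ⟨γ, hγr⟩ hγK hv hv' hc hγv
  refine ⟨(Mγ : GL (Fin g ⊕ Fin g) ℤ), hMN, Lc, hLc, fun b => ?_⟩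
  by_cases hb0 : ((b : 𝓞 M) : M) = 0
  · have hb0' : b = 0 := by exact_mod_cast hb0
    rw [hb0', map_zero, Matrix.mul_zero, Matrix.zero_mul]
  · obtain ⟨t, ht⟩ := exists_unit_coe_eq_one_tmul M _ hb0
    exact hcomm (Mρ a b) t (hMρ v hv a b t ht)

end AuxV

end UnitaryCurve

end Literature.AlgebraicGeometry.ShimuraVarieties

end
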